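import Summits.AtomisticToContinuum.FouriersLaw.Theses.HoelderEscapeProfile

/-!
# Line `duhamel-koopman-transfer` for crux `FibreCalculus` (stmt-AtomisticToContinuum-16011)

Route `HoelderEscapeProfile` (sub-problem `FouriersLaw`), crux r7 `FibreCalculus` = the INFINITE-VOLUME FIBRE CALCULUS
of the Abel escape profile, TWELVE clauses for EVERY guarded arena `(μ, D)` (pinned chain `pinnedChain ω₂ lam β γ`,
`ω₂ lam β > 0`, `T > 0`, shift- and momentum-reversal-invariant DLR state `μ`, a `μ`-preserving shift-covariant
`InfiniteChainDynamics D` — ANY carrier): (1) absolutely convergent current correlations; (2) `e^(−νt)C_T ∈ L¹`;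
(3) `e^(−νt)S(x,·) ∈ L¹`; (4) `Σ(1+x²)|S̄_ν| < ∞`; (5) `Σ(1+x²)|S(·,0)| < ∞`; (6) `χ(0) > 0`; (7) `Σ_x S̄_ν(x) = χ(0)`;
(8) Bochner `f̂_ν ≥ 0`; (9) Parseval `∫_(−π)^π f̂_ν = 2πS̄_ν(0)`; (10) `e^(−νt)Σ_x cos(kx)G(x,·) ∈ L¹`; (11) the k-space
conservation law; (12) Helfand–Abel.

## Why a second line: the STUCK point of `Lines/birth.lean` is its stub B (`stub_abelTemperedness`)

The birth line isolates the light cone (clauses (1), (3), (4), (10)) in ONE stub quantified over EVERY guarded `D`.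
Every light-cone / `L²`-locality theorem in the tree (`InfiniteChainDynamics.exists_summable_l2_locality`,
`…Theorems.DrudeDissolution.GramPencilHarmonicChaos.pencilFramework_localityB`, BM 2016 Thm 2.2
`ButtaMarchioro2016_thm22_chain_holds`) needs `hcar : D.carrier = bmGood` — the pathwise Dobrushin–Fritz /
Buttà–Marchioro iteration runs on `𝒳₀`-valued orbits, and an arbitrary `μ`-preserving solution flow has no a priori
growth bound along its orbits (wild Tikhonov-type solutions exist pathwise). Nothing in print or in the tree controls
`∀ D` as typed.

## The lever: Koopman–Liouville generator identification + Cook–Duhamel against the SEVERED flows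

(Marchioro–Pellegrinotti–Pulvirenti 1978, CMP 58, doi:10.1007/bf01609415, §4 and Prop. 3.1 — essential
anti-selfadjointness of the Liouvillian on local observables from `L^p` estimates of the derivatives of the PARTIAL
dynamics w.r.t. the frozen coordinates; Lanford 1975, LNP 38, Prop. 3: uniqueness of `ν`-preserving a.e. flows solving
the equations.) The `∀ D` quantifier is discharged ONCE, abstractly, and everything quantitative is `D`-FREE:

* `stub_koopmanLiouvilleGenerator` (S1, the FIRST LEMMA of the technique; size M–L): for EVERY `μ`-preserving
  `InfiniteChainDynamics D` and every `C¹` cylinder function `f = g ∘ boxRestrict R` with `f, 𝒜f ∈ L²(μ)`: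
  `(f∘φ_s − f)/s → 𝒜f` in `L²(μ)` as `s → 0`, `𝒜 = liouvilleZ` the Liouville operator. Uses ONLY the structure
  fields: orbits are `C¹` solutions on a full-measure carrier (chain rule: `f(φ_s σ) − f(σ) = ∫₀ˢ 𝒜f(φ_u σ)du`),
  `φ_u` isometric on `L²(μ)`, Minkowski, and strong continuity of the Koopman group (a.e. continuity of orbits in the
  product topology + isometry + density of bounded continuous cylinder functions).
* `stub_duhamelLightCone` (S2, HARDEST; size L): given S1's conclusion, for every polynomial `C¹` observable `a` reading
  the sites `−1, 0, 1`: an `L²(μ)`-approximant of `a ∘ φ_t` localised in `[−(n+2), n+2]` with error `ε_n(t)`,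
  `Σ_n (1+n)² ε_n(t) ≤ A(1+|t|)^m`. Mechanism (Cook–Duhamel): with `T^n_s` = LLL severed flow in `[−n, n]`
  (`OscillatorChain.severedFlow`, `condB1_pinnedChain`; preserves `μ`: `measurePreserving_severedFlow_of_isChainGibbsMeasure`)
  and `g_s = a ∘ T^n_s` (a `C¹` cylinder function on `[−n−1, n+1]`),
  `a∘φ_t − a∘T^n_t = ∫₀ᵗ U_{t−s}(𝒜 − 𝒜_n)g_s ds`, `(𝒜 − 𝒜_n)g_s = p_{n+1}∂_{q_{n+1}}g_s + p_{−n−1}∂_{q_{−n−1}}g_s`, so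
  `‖a∘φ_t − a∘T^n_t‖₂ ≤ ∫₀ᵗ ‖(𝒜 − 𝒜_n)g_s‖₂ ds` — a quantity in which `D` DOES NOT OCCUR. The boundary sensitivity of
  the SEVERED orbit is finite-dimensional: Lipschitz rate `L ≤ C(1 + H_Λ^{1/2})` by EXACT conservation of the box
  energy `H_Λ` (walls frozen), first-order lattice iteration `|∂_{q_{n+1}}(T^n_s σ)_0| ≤ (3Ls)^{n+1}/(n+1)!·e^{3Ls}`, good
  event `{H_Λ ≤ K(2n+3)}` (superstability tail off it, fourth moments): super-exponentially small once `√n ≳ C′|s|`,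
  trivial bound `2‖a‖₂` before — hence the polynomial Abel weight `A(1+|t|)^m`.
* `stub_temperedOfLightCone` (S4; size L): the light cone of S2 + exponential `ρ`-mixing of the (unique, transfer-
  operator) DLR state + shift covariance ⇒ clauses (1), (3), (4), (10) (tree: `summable_covariance_comp_chainShift_comp`,
  `exists_summable_majorant_covariance_comp_chainShift`; Abel weights by Tonelli; measurability in `t` from joint
  measurability of the flow on the carrier, Carathéodory).
* `stub_staticStructureFactor`, `stub_bochnerPositivity`, `stub_conservationLawIdentities`: VERBATIM the registered
  stubs A, C, D of `Lines/birth.lean` (shared signatures — one proof serves both lines).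
* `FibreCalculus_of : A → S1 → S2 → S4 → C → D → FibreCalculus` kernel-checked (no `sorry`): S1 feeds S2, S2 feeds S4
  (literal hypothesis passing), then birth's plumbing ((2) = (10) at `k = 0`, (7) = (11) at `k = 0`, (9) Parseval
  `integral_cosSeries_eq`).

Corollary of S1+S2 (not a stub, recorded for the negation census): ALL guarded dynamics of the same `μ` have the same
Koopman group (`a∘φ^D_t = L²-lim a∘T^n_t`), i.e. `φ^D_t = φ^{D'}_t` `μ`-a.e. for each `t` — Lanford's a.e. uniqueness,
so no "exotic guarded D" counterexample to the crux exists.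

## Disproof used
None exists (`ledger crux ls`: only `Lines/birth.*`; no `Disproof.lean`, no `Negative/`, no crux ideas);
`ledger negatives --problem AtomisticToContinuum` (21 entries): the FouriersLaw negatives (OddCorrectorDecay stmt-9139,
FarFieldGaussianity stmt-12890) concern other objects; no stub is an instance of a refuted statement. Harmonic calibration
`lam = β = 0`: every stub HOLDS there (Gaussian severed flows; the crux is fixed-`ν` infrastructure), consistent with
`not_fouriersLawFor_harmonic`.
-/

noncomputable section

open MeasureTheory Filter Topology Set

namespace Summit.AtomisticToContinuum.FouriersLaw.Cruxes.FibreCalculus.DuhamelKoopmanTransfer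

open Literature.MathematicalPhysics.KineticTheory.HeatConduction
open Summit.AtomisticToContinuum.FouriersLaw.Theses.HoelderEscapeProfile (FibreCalculus)

set_option linter.unusedVariables false

/-! ### The registered stubs (`sorry` lives ONLY here) -/

/-- STUB A `stub_staticStructureFactor` (size M; statics of the DLR state; SHARED VERBATIM with `Lines/birth.lean`) — for the split-bond site energy
`h_x = p_x²/2 + U(q_x) + (V(q_(x+1)−q_x) + V(q_x−q_(x−1)))/2` and its STATIC covariance
`S₀(x) = ∫(h_0 − ⟨h_0⟩)(h_x − ⟨h_0⟩)dμ`: `Σ_x (1+x²)|S₀(x)| < ∞` (Gibbs clustering with second moment: transfer-operator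
spectral gap of the 1-D DLR state, `U ≥ ω₂q²/2`) and `0 < Σ_x S₀(x)` (`= T²c_v`; `≥ T²/2` from the i.i.d. Gaussian
momenta, the configurational asymptotic variance being `≥ 0`). No dynamics enters.
[cite: LanfordLebowitzLieb1977, §4] [cite: Georgii2011, Def. 1.23] [cite: BonettoLebowitzReyBellet2000, §7] -/
theorem stub_staticStructureFactor :
    ∀ ω₂ lam β γ : ℝ, 0 < ω₂ → 0 < lam → 0 < β → ∀ T : ℝ, 0 < T →
    ∀ μ : Measure ChainConfig, (pinnedChain ω₂ lam β γ).IsChainGibbsMeasure T μ → IsShiftInvariant μ →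
    μ.map (fun σ : ChainConfig => fun x : ℤ => ((σ x).1, -(σ x).2)) = μ →
    ∀ h : ChainConfig → ℤ → ℝ,
      h = (fun (σ : ChainConfig) (x : ℤ) => (σ x).2 ^ 2 / 2 + (pinnedChain ω₂ lam β γ).U (σ x).1 +
        ((pinnedChain ω₂ lam β γ).V ((σ (x + 1)).1 - (σ x).1) +
          (pinnedChain ω₂ lam β γ).V ((σ x).1 - (σ (x - 1)).1)) / 2) →
    ∀ S₀ : ℤ → ℝ,
      S₀ = (fun x : ℤ => ∫ σ, (h σ 0 - ∫ σ', h σ' 0 ∂μ) * (h σ x - ∫ σ', h σ' 0 ∂μ) ∂μ) →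
    Summable (fun x : ℤ => (1 + (x : ℝ) ^ 2) * |S₀ x|) ∧ 0 < ∑' x : ℤ, S₀ x := by
  sorry

/-- STUB S1 `stub_koopmanLiouvilleGenerator` (size M–L; the FIRST LEMMA of the line — Koopman–Liouville generator
identification for an ARBITRARY measure-preserving solution flow). For the pinned chain, a DLR state `μ` (only
"probability measure" is used) and ANY `InfiniteChainDynamics D` preserving `μ`: for every `C¹` cylinder function
`f = g ∘ boxRestrict R` with `f ∈ L²(μ)` and `𝒜f = liouvilleZ P f ∈ L²(μ)`, the difference quotients `(f∘φ_s − f)/s`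
converge to `𝒜f` in `L²(μ)` as `s → 0` (`s ≠ 0`; stated junk-free with `eLpNorm`). Mechanism: on the full-measure carrier the orbits are `C¹` solutions,
so `f(φ_s σ) − f(σ) = ∫₀ˢ 𝒜f(φ_u σ) du` (chain rule); Minkowski/Jensen in `u` and measure preservation reduce the claim
to strong continuity `u ↦ (𝒜f)∘φ_u` in `L²(μ)`, which holds for every `L²` function by density of bounded continuous
cylinder functions (dominated convergence along a.e.-continuous orbits) and the isometry of `φ_u`.
[cite: MarchioroPellegrinottiPulvirenti1978, §2 Def. 2.10 and Def. 2.13] [cite: LanfordLebowitzLieb1977, §2 eqs. (1a)–(1b)] -/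
theorem stub_koopmanLiouvilleGenerator :
    ∀ ω₂ lam β γ : ℝ, 0 < ω₂ → 0 < lam → 0 < β → ∀ T : ℝ, 0 < T →
    ∀ μ : Measure ChainConfig, (pinnedChain ω₂ lam β γ).IsChainGibbsMeasure T μ →
    ∀ D : InfiniteChainDynamics (pinnedChain ω₂ lam β γ), D.PreservesMeasure μ →
    ∀ (R : ℕ) (g : (Fin (2 * R + 1) → ℝ × ℝ) → ℝ), ContDiff ℝ 1 g →
      MemLp (fun σ : ChainConfig => g (boxRestrict R σ)) 2 μ →
      MemLp (liouvilleZ (pinnedChain ω₂ lam β γ) (fun σ : ChainConfig => g (boxRestrict R σ))) 2 μ →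
      Tendsto (fun s : ℝ => eLpNorm (fun σ : ChainConfig =>
          (g (boxRestrict R (D.flow s σ)) - g (boxRestrict R σ)) / s -
            liouvilleZ (pinnedChain ω₂ lam β γ) (fun σ' : ChainConfig => g (boxRestrict R σ')) σ) 2 μ)
        (𝓝[≠] (0 : ℝ)) (𝓝 0) := by
  sorry

/-- STUB S2 `stub_duhamelLightCone` (size L; HARDEST — Cook–Duhamel `L²` light cone for EVERY `μ`-preserving solution
flow, with a polynomial Abel weight). Given the Koopman core property of S1 for `(μ, D)`: for every `C¹` observable
`a = g ∘ boxRestrict 1` reading the sites `−1, 0, 1` with polynomially bounded gradient (e.g. the split-bond site energy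
`h_0` and the bond current `j_0`), there are `A`, `m` and errors `ε_n(t) ≥ 0` with `Σ_{n<N} (1+n)² ε_n(t) ≤ A(1+|t|)^m`
such that `a ∘ φ_t` is within `ε_n(t)` in `L²(μ)` of a measurable square-integrable observable localised in
`[−(n+2), n+2]` (the shape consumed by `summable_covariance_comp_chainShift_comp`). Mechanism: approximant
`a ∘ T^n_t` (LLL severed flow in `[−n, n]`, `OscillatorChain.severedFlow (condB1_pinnedChain …)`, `μ`-preserving by
`measurePreserving_severedFlow_of_isChainGibbsMeasure`); Cook–Duhamel
`a∘φ_t − a∘T^n_t = ∫₀ᵗ U_{t−s}(𝒜 − 𝒜_n)(a∘T^n_s) ds` (S1 applied to the `C¹` cylinder functions `a∘T^n_s`; the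
severed Koopman orbit is `L²`-differentiable with derivative `𝒜_n`), `(𝒜 − 𝒜_n)(a∘T^n_s) = p_{±(n+1)}∂_{q_{±(n+1)}}(a∘T^n_s)`,
isometry of `U_{t−s}`: `‖a∘φ_t − a∘T^n_t‖₂ ≤ ∫₀ᵗ‖(𝒜 − 𝒜_n)(a∘T^n_s)‖₂ ds`, a `D`-FREE quantity; the severed boundary
sensitivity is `≤ ‖∇a‖(3Ls)^{n+1}e^{3Ls}/(n+1)!` with `L ≤ C(1 + H_Λ^{1/2})` by exact conservation of the box energy,
controlled on `{H_Λ ≤ K(2n+3)}` and by the superstability tail + fourth moments off it; `ε_n(t) = ‖a‖₂` (approximant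
`0`) below the crossover `n ≲ t²`. [cite: MarchioroPellegrinottiPulvirenti1978, §3 Prop. 3.1 and §4 (4.9)–(4.14)]
[cite: LanfordLebowitzLieb1977, §2 eqs. (9a)–(9c) and §4 remark (i)] [cite: ButtaMarchioro2016, §3 eqs. (3.14)–(3.16)] -/
theorem stub_duhamelLightCone :
    ∀ ω₂ lam β γ : ℝ, 0 < ω₂ → 0 < lam → 0 < β → ∀ T : ℝ, 0 < T →
    ∀ μ : Measure ChainConfig, (pinnedChain ω₂ lam β γ).IsChainGibbsMeasure T μ → IsShiftInvariant μ →
    ∀ D : InfiniteChainDynamics (pinnedChain ω₂ lam β γ), D.PreservesMeasure μ →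
    (∀ (R : ℕ) (g : (Fin (2 * R + 1) → ℝ × ℝ) → ℝ), ContDiff ℝ 1 g →
      MemLp (fun σ : ChainConfig => g (boxRestrict R σ)) 2 μ →
      MemLp (liouvilleZ (pinnedChain ω₂ lam β γ) (fun σ : ChainConfig => g (boxRestrict R σ))) 2 μ →
      Tendsto (fun s : ℝ => eLpNorm (fun σ : ChainConfig =>
          (g (boxRestrict R (D.flow s σ)) - g (boxRestrict R σ)) / s -
            liouvilleZ (pinnedChain ω₂ lam β γ) (fun σ' : ChainConfig => g (boxRestrict R σ')) σ) 2 μ)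
        (𝓝[≠] (0 : ℝ)) (𝓝 0)) →
    ∀ g : (Fin (2 * 1 + 1) → ℝ × ℝ) → ℝ, ContDiff ℝ 1 g →
      (∃ Cg : ℝ, ∃ dg : ℕ, ∀ y, ‖fderiv ℝ g y‖ ≤ Cg * (1 + ‖y‖) ^ dg) →
      ∃ (A : ℝ) (m : ℕ) (ε : ℕ → ℝ → ℝ), (∀ (n : ℕ) (t : ℝ), 0 ≤ ε n t) ∧
        (∀ (t : ℝ) (N : ℕ), ∑ n ∈ Finset.range N, (1 + (n : ℝ)) ^ 2 * ε n t ≤ A * (1 + |t|) ^ m) ∧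
        ∀ (n : ℕ) (t : ℝ), ∃ hl : ChainConfig → ℝ,
          DependsOn hl (Set.Icc (-((n + 2 : ℕ) : ℤ)) ((n + 2 : ℕ) : ℤ)) ∧ Measurable hl ∧ MemLp hl 2 μ ∧
          Real.sqrt (∫ σ, (g (boxRestrict 1 (D.flow t σ)) - hl σ) ^ 2 ∂μ) ≤ ε n t := by
  sorry

/-- STUB S4 `stub_temperedOfLightCone` (size L; clustering transfer + Abel bookkeeping). For every guarded `(μ, D)`
(shift-invariant DLR state, `μ`-preserving shift-covariant dynamics) enjoying the `L²` light cone of S2 for all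
polynomial `C¹` observables reading `−1, 0, 1`: (1) the current correlations `⟨j_0, j_x∘φ_t⟩` are absolutely summable
in `x` at every `t`; (3) `t ↦ e^(−νt)S(x,t)` is integrable on `(0,∞)`; (4) `Σ_x(1+x²)|S̄_ν(x)| < ∞`; (10)
`t ↦ e^(−νt)Σ_x cos(kx)G(x,t)` is integrable on `(0,∞)` (`ν > 0`). Mechanism: shift invariance/covariance move the
evolved observable to the origin (`⟨j_0, j_x∘φ_t⟩ = ⟨j_{−x}, j_0∘φ_t⟩`); the light cone + exponential `ρ`-mixing of the
unique transfer-operator DLR state give `Σ_x (1+x²)(|S(x,t)| + |G(x,t)|) ≤ A′(1+|t|)^m`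
(`exists_summable_majorant_covariance_comp_chainShift`, `summable_covariance_comp_chainShift_comp`); `|S| ≤ Var h_0`,
measurability of `t ↦ S(x,t)`, `G(x,t)` from joint measurability of the flow on the carrier (Carathéodory); Tonelli for
the Abel weights `e^(−νt)`. [cite: ButtaMarchioro2016, §3] [cite: BonettoLebowitzReyBellet2000, §7 eq. (37)] -/
theorem stub_temperedOfLightCone :
    ∀ ω₂ lam β γ : ℝ, 0 < ω₂ → 0 < lam → 0 < β → ∀ T : ℝ, 0 < T →
    ∀ μ : Measure ChainConfig, (pinnedChain ω₂ lam β γ).IsChainGibbsMeasure T μ → IsShiftInvariant μ →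
    ∀ D : InfiniteChainDynamics (pinnedChain ω₂ lam β γ), D.PreservesMeasure μ →
    (∀ t : ℝ, ∀ᵐ σ ∂μ, D.flow t (shift σ) = shift (D.flow t σ)) →
    (∀ g : (Fin (2 * 1 + 1) → ℝ × ℝ) → ℝ, ContDiff ℝ 1 g →
      (∃ Cg : ℝ, ∃ dg : ℕ, ∀ y, ‖fderiv ℝ g y‖ ≤ Cg * (1 + ‖y‖) ^ dg) →
      ∃ (A : ℝ) (m : ℕ) (ε : ℕ → ℝ → ℝ), (∀ (n : ℕ) (t : ℝ), 0 ≤ ε n t) ∧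
        (∀ (t : ℝ) (N : ℕ), ∑ n ∈ Finset.range N, (1 + (n : ℝ)) ^ 2 * ε n t ≤ A * (1 + |t|) ^ m) ∧
        ∀ (n : ℕ) (t : ℝ), ∃ hl : ChainConfig → ℝ,
          DependsOn hl (Set.Icc (-((n + 2 : ℕ) : ℤ)) ((n + 2 : ℕ) : ℤ)) ∧ Measurable hl ∧ MemLp hl 2 μ ∧
          Real.sqrt (∫ σ, (g (boxRestrict 1 (D.flow t σ)) - hl σ) ^ 2 ∂μ) ≤ ε n t) →
    ∀ h : ChainConfig → ℤ → ℝ,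
      h = (fun (σ : ChainConfig) (x : ℤ) => (σ x).2 ^ 2 / 2 + (pinnedChain ω₂ lam β γ).U (σ x).1 +
        ((pinnedChain ω₂ lam β γ).V ((σ (x + 1)).1 - (σ x).1) +
          (pinnedChain ω₂ lam β γ).V ((σ x).1 - (σ (x - 1)).1)) / 2) →
    ∀ S : ℤ → ℝ → ℝ,
      S = (fun (x : ℤ) (t : ℝ) =>
        ∫ σ, (h σ 0 - ∫ σ', h σ' 0 ∂μ) * (h (D.flow t σ) x - ∫ σ', h σ' 0 ∂μ) ∂μ) →
    ∀ Sb : ℝ → ℤ → ℝ,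
      Sb = (fun (ν : ℝ) (x : ℤ) => ν * ∫ t in Ioi (0:ℝ), Real.exp (-(ν * t)) * S x t) →
    ∀ G : ℤ → ℝ → ℝ,
      G = (fun (x : ℤ) (t : ℝ) => ∫ σ, (pinnedChain ω₂ lam β γ).bondCurrentZ σ 0 *
        (pinnedChain ω₂ lam β γ).bondCurrentZ (D.flow t σ) x ∂μ) →
    (∀ t : ℝ, D.HasAbsConvergentCorrelation μ t) ∧
    (∀ x : ℤ, ∀ ν : ℝ, 0 < ν →
      IntegrableOn (fun t : ℝ => Real.exp (-(ν * t)) * S x t) (Ioi 0)) ∧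
    (∀ ν : ℝ, 0 < ν → Summable (fun x : ℤ => (1 + (x : ℝ) ^ 2) * |Sb ν x|)) ∧
    (∀ ν : ℝ, 0 < ν → ∀ k : ℝ,
      IntegrableOn (fun t : ℝ => Real.exp (-(ν * t)) * ∑' x : ℤ, Real.cos (k * (x : ℝ)) * G x t) (Ioi 0)) := by
  sorry

/-- STUB C `stub_bochnerPositivity` (size M–L; positive type; SHARED VERBATIM with `Lines/birth.lean`) — in the tempered regime `Σ_x(1+x²)|S̄_ν(x)| < ∞` the
profile transform is non-negative: `f̂_ν(k) = Σ_x cos(kx)S̄_ν(x) ≥ 0` for all `ν > 0`, `k ∈ ℝ`. Mechanism: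
`x ↦ S̄_ν(x)` is positive-definite on `ℤ` — by shift invariance `Σ_(x,y) c_x c_y S̄_ν(x−y) = ν∫₀^∞e^(−νt)Cov(g, g∘φ_t)dt`
with `g = Σ_x c_x h_x`, and the Abel mean of an autocorrelation under a measure-preserving flow is `≥ 0`
(`ν∫e^(−νu)F(u)du = ν³∫₀^∞e^(−νt)(∫_(0,t](t−u)F(u)du)dt ≥ 0` by the doubly-integrated positive-type lemma
`InfiniteChainDynamics.integral_Ioc_sub_mul_nonneg` of `Literature/…/InfiniteChainCurrentPositiveType` — no Stone theorem
needed); then Fejér/Herglotz for the (symmetrised) summable positive-definite sequence — evenness of `S̄_ν` in `x` is not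
needed. [cite: BonettoLebowitzReyBellet2000, §7] [cite: Helfand1960] -/
theorem stub_bochnerPositivity :
    ∀ ω₂ lam β γ : ℝ, 0 < ω₂ → 0 < lam → 0 < β → ∀ T : ℝ, 0 < T →
    ∀ μ : Measure ChainConfig, (pinnedChain ω₂ lam β γ).IsChainGibbsMeasure T μ → IsShiftInvariant μ →
    μ.map (fun σ : ChainConfig => fun x : ℤ => ((σ x).1, -(σ x).2)) = μ →
    ∀ D : InfiniteChainDynamics (pinnedChain ω₂ lam β γ), D.PreservesMeasure μ →
    (∀ t : ℝ, ∀ᵐ σ ∂μ, D.flow t (shift σ) = shift (D.flow t σ)) →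
    ∀ h : ChainConfig → ℤ → ℝ,
      h = (fun (σ : ChainConfig) (x : ℤ) => (σ x).2 ^ 2 / 2 + (pinnedChain ω₂ lam β γ).U (σ x).1 +
        ((pinnedChain ω₂ lam β γ).V ((σ (x + 1)).1 - (σ x).1) +
          (pinnedChain ω₂ lam β γ).V ((σ x).1 - (σ (x - 1)).1)) / 2) →
    ∀ S : ℤ → ℝ → ℝ,
      S = (fun (x : ℤ) (t : ℝ) =>
        ∫ σ, (h σ 0 - ∫ σ', h σ' 0 ∂μ) * (h (D.flow t σ) x - ∫ σ', h σ' 0 ∂μ) ∂μ) →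
    ∀ Sb : ℝ → ℤ → ℝ,
      Sb = (fun (ν : ℝ) (x : ℤ) => ν * ∫ t in Ioi (0:ℝ), Real.exp (-(ν * t)) * S x t) →
    (∀ ν : ℝ, 0 < ν → Summable (fun x : ℤ => (1 + (x : ℝ) ^ 2) * |Sb ν x|)) →
    ∀ fh : ℝ → ℝ → ℝ, fh = (fun (ν k : ℝ) => ∑' x : ℤ, Real.cos (k * (x : ℝ)) * Sb ν x) →
    ∀ ν : ℝ, 0 < ν → ∀ k : ℝ, 0 ≤ fh ν k := by
  sorry

/-- STUB D `stub_conservationLawIdentities` (size L; local energy conservation; SHARED VERBATIM with `Lines/birth.lean`; its prover may invoke S1 once landed for the generator step `∂ₜ(h_x∘φ_t) = (j_(x−1) − j_x)∘φ_t` in `L²`) — in the tempered regime (the four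
outputs of `stub_abelTemperedness` and the static clustering of `stub_staticStructureFactor`, listed as hypotheses):
(11) the k-SPACE CONSERVATION LAW `χ(k) − f̂_ν(k) = (2−2cos k)𝒢_ν(k)/ν` for all `ν > 0`, `k`, and (12) HELFAND–ABEL
`∫₀^∞e^(−νt)C_T(t)dt = (ν/2)(Σ_x x²S̄_ν(x) − Σ_x x²S(x,0))`. Mechanism: `d/dt (h_x∘φ_t) = (j_(x−1) − j_x)∘φ_t` for the
split-bond energy and the bond current `j_x = −½(p_x+p_(x+1))V′(q_(x+1)−q_x)`, stationarity and momentum-reversal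
evenness (`∂ₜS(x,0) = 0`) give `∂ₜ²S = Δ_xG`; two Abel integrations by parts give `ν(S̄_ν − S(·,0)) = Δ_xG_ν`, whose
cosine transform is (11) and whose second k-moment at `0` is (12) (`C_T = Σ_xG(x,·)`).
[cite: Helfand1960] [cite: BonettoLebowitzReyBellet2000, §7 eq. (37)] [cite: arXiv:1103.2835] -/
theorem stub_conservationLawIdentities :
    ∀ ω₂ lam β γ : ℝ, 0 < ω₂ → 0 < lam → 0 < β → ∀ T : ℝ, 0 < T →
    ∀ μ : Measure ChainConfig, (pinnedChain ω₂ lam β γ).IsChainGibbsMeasure T μ → IsShiftInvariant μ →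
    μ.map (fun σ : ChainConfig => fun x : ℤ => ((σ x).1, -(σ x).2)) = μ →
    ∀ D : InfiniteChainDynamics (pinnedChain ω₂ lam β γ), D.PreservesMeasure μ →
    (∀ t : ℝ, ∀ᵐ σ ∂μ, D.flow t (shift σ) = shift (D.flow t σ)) →
    ∀ h : ChainConfig → ℤ → ℝ,
      h = (fun (σ : ChainConfig) (x : ℤ) => (σ x).2 ^ 2 / 2 + (pinnedChain ω₂ lam β γ).U (σ x).1 +
        ((pinnedChain ω₂ lam β γ).V ((σ (x + 1)).1 - (σ x).1) +
          (pinnedChain ω₂ lam β γ).V ((σ x).1 - (σ (x - 1)).1)) / 2) →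
    ∀ S : ℤ → ℝ → ℝ,
      S = (fun (x : ℤ) (t : ℝ) =>
        ∫ σ, (h σ 0 - ∫ σ', h σ' 0 ∂μ) * (h (D.flow t σ) x - ∫ σ', h σ' 0 ∂μ) ∂μ) →
    ∀ Sb : ℝ → ℤ → ℝ,
      Sb = (fun (ν : ℝ) (x : ℤ) => ν * ∫ t in Ioi (0:ℝ), Real.exp (-(ν * t)) * S x t) →
    ∀ G : ℤ → ℝ → ℝ,
      G = (fun (x : ℤ) (t : ℝ) => ∫ σ, (pinnedChain ω₂ lam β γ).bondCurrentZ σ 0 *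
        (pinnedChain ω₂ lam β γ).bondCurrentZ (D.flow t σ) x ∂μ) →
    ∀ Gh : ℝ → ℝ → ℝ,
      Gh = (fun (ν k : ℝ) =>
        ∫ t in Ioi (0:ℝ), Real.exp (-(ν * t)) * ∑' x : ℤ, Real.cos (k * (x : ℝ)) * G x t) →
    ∀ fh : ℝ → ℝ → ℝ, fh = (fun (ν k : ℝ) => ∑' x : ℤ, Real.cos (k * (x : ℝ)) * Sb ν x) →
    ∀ χk : ℝ → ℝ, χk = (fun k : ℝ => ∑' x : ℤ, Real.cos (k * (x : ℝ)) * S x 0) →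
    (∀ t : ℝ, D.HasAbsConvergentCorrelation μ t) →
    (∀ x : ℤ, ∀ ν : ℝ, 0 < ν →
      IntegrableOn (fun t : ℝ => Real.exp (-(ν * t)) * S x t) (Ioi 0)) →
    (∀ ν : ℝ, 0 < ν → Summable (fun x : ℤ => (1 + (x : ℝ) ^ 2) * |Sb ν x|)) →
    Summable (fun x : ℤ => (1 + (x : ℝ) ^ 2) * |S x 0|) →
    (∀ ν : ℝ, 0 < ν → ∀ k : ℝ,
      IntegrableOn (fun t : ℝ => Real.exp (-(ν * t)) * ∑' x : ℤ, Real.cos (k * (x : ℝ)) * G x t) (Ioi 0)) →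
    (∀ ν : ℝ, 0 < ν → ∀ k : ℝ, χk k - fh ν k = (2 - 2 * Real.cos k) * Gh ν k / ν) ∧
    (∀ ν : ℝ, 0 < ν → ∫ t in Ioi (0:ℝ), Real.exp (-(ν * t)) * D.currentCorrelation μ t =
      ν / 2 * ((∑' x : ℤ, (x : ℝ) ^ 2 * Sb ν x) - ∑' x : ℤ, (x : ℝ) ^ 2 * S x 0)) := by
  sorry

/-! ### By-name statements of the registered stubs

`Registered.stub_x` is DEFINITIONALLY the statement of the sorried `theorem stub_x` (`type_of%`), so the composition
`FibreCalculus_of : Registered.stub_staticStructureFactor → … → FibreCalculus` is literally "stub signatures → crux"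
and the closing `example` type-checks the seam. -/

namespace Registered

/-- Statement of registered stub A (`stub_staticStructureFactor`, shared with `Lines/birth.lean`), by name. -/
def stub_staticStructureFactor : Prop := type_of% DuhamelKoopmanTransfer.stub_staticStructureFactor

/-- Statement of registered stub S1 (`stub_koopmanLiouvilleGenerator`), by name. -/
def stub_koopmanLiouvilleGenerator : Prop := type_of% DuhamelKoopmanTransfer.stub_koopmanLiouvilleGenerator

/-- Statement of registered stub S2 (`stub_duhamelLightCone`), by name. -/
def stub_duhamelLightCone : Prop := type_of% DuhamelKoopmanTransfer.stub_duhamelLightCone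

/-- Statement of registered stub S4 (`stub_temperedOfLightCone`), by name. -/
def stub_temperedOfLightCone : Prop := type_of% DuhamelKoopmanTransfer.stub_temperedOfLightCone

/-- Statement of registered stub C (`stub_bochnerPositivity`, shared with `Lines/birth.lean`), by name. -/
def stub_bochnerPositivity : Prop := type_of% DuhamelKoopmanTransfer.stub_bochnerPositivity

/-- Statement of registered stub D (`stub_conservationLawIdentities`, shared with `Lines/birth.lean`), by name. -/
def stub_conservationLawIdentities : Prop := type_of% DuhamelKoopmanTransfer.stub_conservationLawIdentities

end Registered

/-! ### Real analysis (no `sorry`): Parseval at zero for an absolutely summable cosine series (as in `birth`) -/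

/-- Orthogonality of the modes `cos(k·x)`, `x ∈ ℤ`, on `[−π, π]`: termwise integration (dominated convergence with
the constant majorant `|c x|`) of an absolutely summable cosine series picks out `2π·c 0`, because
`∫_(−π)^π cos(kx)dk = (sin(πx) − sin(−πx))/x = 0` for `x ≠ 0` and `= 2π` for `x = 0`. [folklore] -/
theorem integral_cosSeries_eq (c : ℤ → ℝ) (hc : Summable fun x : ℤ => |c x|) :
    ∫ k in (-Real.pi)..Real.pi, ∑' x : ℤ, Real.cos (k * (x : ℝ)) * c x = 2 * Real.pi * c 0 := by
  -- each mode separately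
  have hmode : ∀ x : ℤ, ∫ k in (-Real.pi)..Real.pi, Real.cos (k * (x : ℝ)) * c x
      = if x = 0 then 2 * Real.pi * c 0 else 0 := by
    intro x
    rw [intervalIntegral.integral_mul_const]
    split_ifs with hx
    · subst hx
      simp only [Int.cast_zero, mul_zero, Real.cos_zero, intervalIntegral.integral_const, smul_eq_mul, mul_one]
      ring
    · have hx' : (x : ℝ) ≠ 0 := by exact_mod_cast hx
      have h1 : Real.sin (Real.pi * (x : ℝ)) = 0 := by
        rw [mul_comm]; exact Real.sin_int_mul_pi x
      have h2 : Real.sin (-Real.pi * (x : ℝ)) = 0 := by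
        rw [neg_mul, Real.sin_neg, h1, neg_zero]
      rw [intervalIntegral.integral_comp_mul_right Real.cos hx', integral_cos, h1, h2]
      simp
  -- the pointwise bound `|cos(kx) c x| ≤ |c x|`
  have hbd : ∀ (x : ℤ) (k : ℝ), ‖Real.cos (k * (x : ℝ)) * c x‖ ≤ |c x| := fun x k => by
    rw [Real.norm_eq_abs, abs_mul]
    exact mul_le_of_le_one_left (abs_nonneg _) (Real.abs_cos_le_one _)
  -- termwise integration
  have hsum : HasSum (fun x : ℤ => ∫ k in (-Real.pi)..Real.pi, Real.cos (k * (x : ℝ)) * c x)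
      (∫ k in (-Real.pi)..Real.pi, ∑' x : ℤ, Real.cos (k * (x : ℝ)) * c x) := by
    refine intervalIntegral.hasSum_integral_of_dominated_convergence (fun x _ => |c x|)
      (fun x => ?_) (fun x => ?_) ?_ ?_ ?_
    · exact ((Real.continuous_cos.comp (continuous_id.mul continuous_const)).mul
        continuous_const).aestronglyMeasurable
    · exact Eventually.of_forall fun k _ => hbd x k
    · exact Eventually.of_forall fun k _ => hc
    · exact intervalIntegrable_const
    · exact Eventually.of_forall fun k _ => (Summable.of_norm_bounded hc (fun x => hbd x k)).hasSum
  have hite : HasSum (fun x : ℤ => if x = 0 then 2 * Real.pi * c 0 else (0 : ℝ))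
      (∫ k in (-Real.pi)..Real.pi, ∑' x : ℤ, Real.cos (k * (x : ℝ)) * c x) := by
    simp only [hmode] at hsum
    exact hsum
  exact hite.unique (hasSum_ite_eq (0 : ℤ) (2 * Real.pi * c 0))

/-! ### The composition (kernel-checked, no `sorry`): the six stubs give the crux BY NAME -/

/-- `A → S1 → S2 → S4 → C → D → FibreCalculus`. The Koopman core (S1) is passed to the Cook–Duhamel light cone (S2),
whose conclusion is passed to the clustering transfer (S4), which delivers the temperedness package (1), (3), (4), (10)
for the guarded `(μ, D)` at hand; then birth's plumbing: (2) = (10) at `k = 0`, (7) = (11) at `k = 0`, (9) =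
`integral_cosSeries_eq` from (4), `S(x,0) = S₀(x)` by `φ_0 = id` a.e. [folklore] -/
theorem FibreCalculus_of (hA : Registered.stub_staticStructureFactor)
    (hK : Registered.stub_koopmanLiouvilleGenerator) (hL : Registered.stub_duhamelLightCone)
    (hT' : Registered.stub_temperedOfLightCone)
    (hC : Registered.stub_bochnerPositivity) (hD : Registered.stub_conservationLawIdentities) :
    FibreCalculus := by
  intro ω₂ lam β γ hω hl hβ T hT μ hG hSI hRefl D hP hShift h hh S hS Sb hSb G hGd Gh hGh fh hfh χk hχk
  -- S1: the Koopman core of (μ, D)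
  have hcore := hK ω₂ lam β γ hω hl hβ T hT μ hG D hP
  -- S2: the Cook–Duhamel light cone for every polynomial C¹ observable reading [-1, 1]
  have hcone := hL ω₂ lam β γ hω hl hβ T hT μ hG hSI D hP hcore
  -- S4: (1), (3), (4), (10) — the temperedness package, for THIS guarded (μ, D)
  obtain ⟨hAC, hIntS, hSumSb, hIntG⟩ :=
    hT' ω₂ lam β γ hω hl hβ T hT μ hG hSI D hP hShift hcone h hh S hS Sb hSb G hGd
  -- (5), (6): statics — `S x 0` is the static covariance since `φ_0 = id` `μ`-a.e.
  have hS0 : (fun x : ℤ => S x 0) =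
      (fun x : ℤ => ∫ σ, (h σ 0 - ∫ σ', h σ' 0 ∂μ) * (h σ x - ∫ σ', h σ' 0 ∂μ) ∂μ) := by
    funext x
    simp only [hS]
    refine integral_congr_ae ?_
    filter_upwards [hP.1] with σ hσ
    rw [D.flow_zero σ hσ]
  obtain ⟨hSumS0, hχpos⟩ := hA ω₂ lam β γ hω hl hβ T hT μ hG hSI hRefl h hh (fun x : ℤ => S x 0) hS0
  have hSumS0' : Summable (fun x : ℤ => (1 + (x : ℝ) ^ 2) * |S x 0|) := by simpa using hSumS0
  have hχ0 : χk 0 = ∑' x : ℤ, S x 0 := by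
    simp only [hχk, zero_mul, Real.cos_zero, one_mul]
  have hχpos' : 0 < χk 0 := by rw [hχ0]; simpa using hχpos
  -- (8): Bochner positivity in the tempered regime
  have hBoch : ∀ ν : ℝ, 0 < ν → ∀ k : ℝ, 0 ≤ fh ν k :=
    hC ω₂ lam β γ hω hl hβ T hT μ hG hSI hRefl D hP hShift h hh S hS Sb hSb hSumSb fh hfh
  -- (11), (12): the conservation-law identities in the tempered regime
  obtain ⟨hId, hHelf⟩ :=
    hD ω₂ lam β γ hω hl hβ T hT μ hG hSI hRefl D hP hShift h hh S hS Sb hSb G hGd Gh hGh fh hfh χk hχk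
      hAC hIntS hSumSb hSumS0' hIntG
  -- (2) from (10) at `k = 0`
  have hIntC : ∀ ν : ℝ, 0 < ν →
      IntegrableOn (fun t : ℝ => Real.exp (-(ν * t)) * D.currentCorrelation μ t) (Ioi 0) := by
    intro ν hν
    have h0 := hIntG ν hν 0
    simp only [zero_mul, Real.cos_zero, one_mul, hGd] at h0
    exact h0
  -- (7) from (11) at `k = 0`
  have hcons : ∀ ν : ℝ, 0 < ν → ∑' x : ℤ, Sb ν x = χk 0 := by
    intro ν hν
    have e := hId ν hν 0
    have hf0 : fh ν 0 = ∑' x : ℤ, Sb ν x := by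
      simp only [hfh, zero_mul, Real.cos_zero, one_mul]
    rw [Real.cos_zero, hf0] at e
    have hz : (2 - 2 * (1 : ℝ)) * Gh ν 0 / ν = 0 := by ring
    linarith
  -- (9) Parseval at zero from (4)
  have hPars : ∀ ν : ℝ, 0 < ν → ∫ k in (-Real.pi)..Real.pi, fh ν k = 2 * Real.pi * Sb ν 0 := by
    intro ν hν
    have habs : Summable fun x : ℤ => |Sb ν x| :=
      Summable.of_nonneg_of_le (fun x => abs_nonneg _)
        (fun x => le_mul_of_one_le_left (abs_nonneg _) (by nlinarith [sq_nonneg (x : ℝ)])) (hSumSb ν hν)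
    simp only [hfh]
    exact integral_cosSeries_eq (Sb ν) habs
  exact ⟨hAC, hIntC, hIntS, hSumSb, hSumS0', hχpos', hcons, hBoch, hPars, hIntG, hId, hHelf⟩

/-- Type-check of the seam (an `example`, adds nothing to the environment): the sorried stubs are literally the
antecedents of `FibreCalculus_of`. -/
example : FibreCalculus :=
  FibreCalculus_of stub_staticStructureFactor stub_koopmanLiouvilleGenerator stub_duhamelLightCone
    stub_temperedOfLightCone stub_bochnerPositivity stub_conservationLawIdentities

end Summit.AtomisticToContinuum.FouriersLaw.Cruxes.FibreCalculus.DuhamelKoopmanTransfer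

end
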